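import Summits.CriticalPhenomena.CardyFormulaZ2.Theses.CardySelfDualSegment
import Literature.Probability.Percolation.CornerPercolation
import Literature.Probability.Percolation.QuadCrossingSquareModel
import Literature.Probability.Percolation.LatticeWalksGM
import Literature.Probability.LatticeModels.ProdBernoulliIndependence
import Literature.Barriers.CriticalPhenomena.EmbeddingModulusUniquenessProofs
import Literature.Probability.RandomPlanarGeometry.RectangleModulusAspectRatio
import Literature.Probability.RandomPlanarGeometry.CrossRatioContinuity
import Literature.Probability.RandomPlanarGeometry.ImageUnivalent
import Literature.Probability.RandomPlanarGeometry.CardyFunctionIncBeta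
import HarnessLib

/-!
# Skeleton of line `Sketch` for crux `SegmentClosed` (stmt-CriticalPhenomena-5473)

Route `CardySelfDualSegment` of `CriticalPhenomena/CardyFormulaZ2`. The crux says: assuming the
uniform box-crossing property of the corner models `M_t` (UBC) and uniform marginality (UM), the
good set `G = {t ∈ [0,1] | ∃ α, 0 < im α ∧ CardyMod t α}` is closed.

Composition (`segmentClosed_of_stubs`): test `CardyMod t α` on the pre-sheared boxes
`(rectQuad 0 w 0 h).map (shearHomeomorph β)`, `β = (i - re α)/im α` (`pullback_constant`: the
Cardy side is then the constant `F(η_box)`); `stub_confinement` confines `β` to a compact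
`K ⊆ ℍ` using UBC only (forced gates `stub_gateLR`/`stub_gateTB`, inscribed boxes
`stub_inscribedTB` + `stub_indepBoxes`, Cardy values of boxes `stub_boxCrossRatio`);
`stub_identification` (Radó + 3ε from UM) passes `CardyMod` to limits; closedness is the closed
projection `[0,1] × K → [0,1]` done with sequences.
-/

noncomputable section

open Set Filter Metric MeasureTheory Complex
open scoped Topology
open UpperHalfPlane (upperHalfPlaneSet)
open Literature.Probability.RandomPlanarGeometry Literature.Probability.Percolation
open Literature.Probability.LatticeModels Literature.Barriers.CriticalPhenomena

namespace Summit.CriticalPhenomena.CardyFormulaZ2.Cruxes.SegmentClosed.Sketch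

/-! ### Lattice stubs (forced gates, inscribed boxes, independence) -/

/-- **Forced vertical gate.** If every point of `Ω` within `2δ` of `A` has `re ≤ x₁`, every
point of `Ω` within `2δ` of `B` has `re ≥ x₂`, and the part of `Ω` in the vertical slab
`x₁ ≤ re ≤ x₂` has `im ∈ [y₁, y₂]`, then a crude crossing of `Ω` from `A` to `B` at mesh `δ`
by nearest-neighbour edges of `ℤ²` (drawn by `squareLatticeEmbedding.z = √2·`) contains a
left–right crossing of a translate of the lattice box `[0, a] × [0, b]` whenever
`a ≤ (x₂ - x₁)/δ - 4` and `b ≥ (y₂ - y₁)/δ` (clip the open walk at two lattice columns,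
`exists_openConnIn_clip`). -/
theorem stub_gateLR (Ω A B : Set ℂ) {δ x₁ x₂ y₁ y₂ a b : ℝ} (hδ : 0 < δ)
    (hA : ∀ p ∈ Ω, infDist p A ≤ 2 * δ → p.re ≤ x₁)
    (hB : ∀ p ∈ Ω, infDist p B ≤ 2 * δ → x₂ ≤ p.re)
    (hΩ : ∀ p ∈ Ω, x₁ ≤ p.re → p.re ≤ x₂ → y₁ ≤ p.im ∧ p.im ≤ y₂)
    (ha : 0 ≤ a) (hax : a ≤ (x₂ - x₁) / δ - 4) (hb : (y₂ - y₁) / δ ≤ b) :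
    ∃ w : ℂ, ∀ ω : BondConfig (Site 2), ω ⊆ (zdGraph 2).edgeSet →
      ω ∈ embDomainCrossing squareLatticeEmbedding.z Ω δ A B →
      ω ∈ embRectCrossing (fun v => squareLatticeEmbedding.z v - w) a b := by
  sorry

/-- **Forced horizontal gate.** The transposed statement: if every point of `Ω` within `2δ` of
`A` has `im ≤ y₁`, every point of `Ω` within `2δ` of `B` has `im ≥ y₂`, and the part of `Ω` in
the horizontal slab `y₁ ≤ im ≤ y₂` has `re ∈ [x₁, x₂]`, then a crude crossing contains a
top–bottom crossing of a translate of `[0, a] × [0, b]` whenever `b ≤ (y₂ - y₁)/δ - 4` and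
`a ≥ (x₂ - x₁)/δ`. -/
theorem stub_gateTB (Ω A B : Set ℂ) {δ x₁ x₂ y₁ y₂ a b : ℝ} (hδ : 0 < δ)
    (hA : ∀ p ∈ Ω, infDist p A ≤ 2 * δ → p.im ≤ y₁)
    (hB : ∀ p ∈ Ω, infDist p B ≤ 2 * δ → y₂ ≤ p.im)
    (hΩ : ∀ p ∈ Ω, y₁ ≤ p.im → p.im ≤ y₂ → x₁ ≤ p.re ∧ p.re ≤ x₂)
    (hb : 0 ≤ b) (hby : b ≤ (y₂ - y₁) / δ - 4) (ha : (x₂ - x₁) / δ ≤ a) :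
    ∃ w : ℂ, ∀ ω : BondConfig (Site 2), ω ⊆ (zdGraph 2).edgeSet →
      ω ∈ embDomainCrossing squareLatticeEmbedding.z Ω δ A B →
      ω ∈ embTBCrossing (fun v => squareLatticeEmbedding.z v - w) a b := by
  sorry

/-- **Inscribed box.** If the closed-in-`re`, open-in-`im` box `[x₁, x₂] × (y₁, y₂)` lies in
`Ω`, its points of height in `(y₁, y₁ + 2δ]` are within `2δ` of `A` and its points of height in
`[y₂ - 2δ, y₂)` are within `2δ` of `B`, then a top–bottom crossing of the lattice box
`w + [0, a] × [0, b]`, `w = (x₁ + i y₁)/δ`, `a ≤ (x₂ - x₁)/δ`, `b ≥ (y₂ - y₁)/δ`, by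
nearest-neighbour edges is a crude crossing of `Ω` from `A` to `B` at mesh `δ` (clip the walk
at the first lattice row above `y₁/δ` and the last one below `y₂/δ`). -/
theorem stub_inscribedTB (Ω A B : Set ℂ) {δ x₁ x₂ y₁ y₂ a b : ℝ} (hδ : 0 < δ)
    (hΩ : ∀ p : ℂ, x₁ ≤ p.re → p.re ≤ x₂ → y₁ < p.im → p.im < y₂ → p ∈ Ω)
    (hA : ∀ p : ℂ, x₁ ≤ p.re → p.re ≤ x₂ → y₁ < p.im → p.im ≤ y₁ + 2 * δ → infDist p A ≤ 2 * δ)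
    (hB : ∀ p : ℂ, x₁ ≤ p.re → p.re ≤ x₂ → y₂ - 2 * δ ≤ p.im → p.im < y₂ → infDist p B ≤ 2 * δ)
    (hy : y₁ + 4 * δ ≤ y₂) (ha : 0 ≤ a) (hax : a ≤ (x₂ - x₁) / δ) (hb : (y₂ - y₁) / δ ≤ b)
    (ω : BondConfig (Site 2)) (hω : ω ⊆ (zdGraph 2).edgeSet)
    (h : ω ∈ embTBCrossing
      (fun v => squareLatticeEmbedding.z v - (((x₁ / δ : ℝ) : ℂ) + ((y₁ / δ : ℝ) : ℂ) * I)) a b) :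
    ω ∈ embDomainCrossing squareLatticeEmbedding.z Ω δ A B := by
  sorry

/-- **Independent boxes.** Top–bottom crossings of lattice boxes `w k + [0, a] × [0, b]` with
pairwise disjoint column ranges are independent under the corner model `M_t` (each is determined
by the coins and splitting bits of the vertices of its own box, and `M_t` is a product measure
pushed forward by the corner map), so if each has probability `≥ c` their union has probability
`≥ 1 - (1 - c)^K` (`prodBernoulli_real_inter_biInter_of_determinedBy`). -/
theorem stub_indepBoxes (t : unitInterval) {K : ℕ} (w : Fin K → ℂ) {a b c : ℝ} (ha : 0 ≤ a)
    (hsep : ∀ i j : Fin K, i ≠ j → (w i).re + a < (w j).re ∨ (w j).re + a < (w i).re)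
    (hc : ∀ k, c ≤ (cornerPercolation t).real
      (embTBCrossing (fun v => squareLatticeEmbedding.z v - w k) a b)) :
    1 - (1 - c) ^ K ≤ (cornerPercolation t).real
      (⋃ k, embTBCrossing (fun v => squareLatticeEmbedding.z v - w k) a b) := by
  sorry

/-! ### Conformal stub: the modulus of the bottom/top-marked box -/

/-- **Cardy cross-ratio of the model rectangle `rectQuad`.** `rectQuad 0 w 0 h` is the box
`(0,w) × (0,h)` with corners marked counterclockwise from the bottom-left one (arc `0` = bottom,
arc `2` = top); it is the cyclic shift by one of the marking `(ih, 0, w, w + ih)` (arc `0` = left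
side) whose cross-ratio is `η(w/h)` (`rectangle_crossRatio_eq_of_aspectRatio`, hypothesis `hη`),
so its cross-ratio is `1 - η(w/h)` (Möbius renormalisation of the shifted boundary tuple,
`ConformalRectangle.exists_isUniformizing_of_cyclic` pattern, and `crossRatio` of the shifted
tuple is `1 -` the original). -/
theorem stub_boxCrossRatio (η : ℝ → ℝ)
    (hη : ∀ (R : ConformalRectangle) (w h : ℝ), 0 < w → 0 < h →
      R.carrier = (Ioo (0:ℝ) w ×ℂ Ioo (0:ℝ) h) →
      (R.pt 0 = (h:ℂ) * I ∧ R.pt 1 = 0 ∧ R.pt 2 = (w:ℂ) ∧ R.pt 3 = (w:ℂ) + (h:ℂ) * I) →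
      ∀ (φ : ConformalEquiv upperHalfPlaneSet R.carrier) (x : Fin 4 → ℝ), R.IsUniformizing φ x →
        crossRatio x = η (w / h))
    {w h : ℝ} (hw : 0 < w) (hh : 0 < h)
    (φ : ConformalEquiv upperHalfPlaneSet (rectQuad 0 w 0 h hw hh).carrier) (x : Fin 4 → ℝ)
    (hx : (rectQuad 0 w 0 h hw hh).IsUniformizing φ x) :
    crossRatio x = 1 - η (w / h) := by
  sorry

/-! ### Identification stub (Radó + uniform marginality) -/

/-- **Identification of the limit modulus.** If `CardyMod (t n) (α n)` holds along a sequence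
with `t n → t₀`, `α n → α₀`, `im α₀ > 0`, and the crossing probabilities `P` are equicontinuous
in the model parameter at `t₀` uniformly in the mesh (UM), then `CardyMod t₀ α₀`: for
`R = φ_{α₀}(R')` the moduli of `Q_n = φ_{α n}(R')` converge to that of `R` (Radó's theorem,
`ConformalRectangle.tendsto_crossRatio_of_tendstoUniformly`, the sheared boundary loops
converging uniformly), `F` is continuous, and a `3ε` exchange of limits through UM concludes.
Stated for an abstract family `P`. -/
theorem stub_identification (P : unitInterval → ConformalRectangle → ℝ → ℝ)
    (t : ℕ → unitInterval) (t₀ : unitInterval) (α : ℕ → ℂ) (α₀ : ℂ)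
    (ht : Tendsto t atTop (𝓝 t₀)) (hα : Tendsto α atTop (𝓝 α₀))
    (hαn : ∀ n, 0 < (α n).im) (hα₀ : 0 < α₀.im)
    (hUM : ∀ (R : ConformalRectangle) (ε : ℝ), 0 < ε → ∃ η > 0, ∀ s : unitInterval,
      dist s t₀ < η → ∀ δ : ℝ, 0 < δ → |P s R δ - P t₀ R δ| < ε)
    (hmod : ∀ n (R R' : ConformalRectangle) (φ : ConformalEquiv upperHalfPlaneSet R.carrier)
      (x : Fin 4 → ℝ), R.carrier = moduliShear (α n) '' R'.carrier →
      (∀ i, R.pt i = moduliShear (α n) (R'.pt i)) → R.IsUniformizing φ x →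
      Tendsto (P (t n) R') (𝓝[>] 0) (𝓝 (Literature.Probability.RandomPlanarGeometry.cardyFunction (crossRatio x))))
    (R R' : ConformalRectangle) (φ : ConformalEquiv upperHalfPlaneSet R.carrier) (x : Fin 4 → ℝ)
    (hc : R.carrier = moduliShear α₀ '' R'.carrier) (hp : ∀ i, R.pt i = moduliShear α₀ (R'.pt i))
    (hu : R.IsUniformizing φ x) :
    Tendsto (P t₀ R') (𝓝[>] 0) (𝓝 (Literature.Probability.RandomPlanarGeometry.cardyFunction (crossRatio x))) := by
  sorry

/-! ### Confinement stub (lead) -/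

/-- **Moduli confinement from the uniform box-crossing property.** There is a compact
`K ⊆ ℍ`, depending only on the UBC constants at aspect ratios `1/2` and `1` and on Cardy's
function, such that every shear parameter `β ∈ ℍ` for which the crude `M_t`-crossing
probabilities of ALL sheared boxes `φ_β((0,w)×(0,h))` (bottom to top) converge to the Cardy value
of the box lies in `K`: a wide box (Cardy value `> 1 - c`) forces `2 im β - |re β| ≤ A` and
`|re β| ≤ A + im β/2` through one forced gate (`stub_gateTB` / `stub_gateLR` and the UBC upper
bounds), and then `im β ≥ h₀` through `K → ∞` disjoint inscribed squares in a flat parallelogram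
(`stub_inscribedTB`, `stub_indepBoxes` and the UBC lower bounds) against a Cardy value `< 1`. -/
theorem stub_confinement
    (hUBC : ∀ ρ : ℝ, 0 < ρ → ∃ c > 0, ∃ n₀ : ℕ, ∀ t : unitInterval,
      BoxCrossingBounds (cornerPercolation t) squareLatticeEmbedding.z ρ c n₀) :
    ∃ K : Set ℂ, IsCompact K ∧ K ⊆ {β | 0 < β.im} ∧
      ∀ (t : unitInterval) (β : ℂ) (hβ : 0 < β.im),
        (∀ (w h : ℝ) (hw : 0 < w) (hh : 0 < h)
          (φ : ConformalEquiv upperHalfPlaneSet (rectQuad 0 w 0 h hw hh).carrier) (x : Fin 4 → ℝ),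
          (rectQuad 0 w 0 h hw hh).IsUniformizing φ x →
          Tendsto (cornerCrossingProb t ((rectQuad 0 w 0 h hw hh).map (shearHomeomorph β hβ.ne')))
            (𝓝[>] 0) (𝓝 (Literature.Probability.RandomPlanarGeometry.cardyFunction (crossRatio x)))) →
        β ∈ K := by
  sorry

/-! ### Composition -/

/-- **Pull-back of the test box.** If `CardyMod t α` holds (`0 < im α`) then for every box
`(0,w)×(0,h)` with uniformizing datum `(φ, x)` the crude `M_t`-crossing probability of the
pre-sheared box `φ_β((0,w)×(0,h))`, `β = (i - re α)/im α` (so that `φ_α ∘ φ_β = id`), tends to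
`F(crossRatio x)`. -/
theorem pullback_constant {t : unitInterval} {α : ℂ} (hα : 0 < α.im)
    (hmod : ∀ (R R' : ConformalRectangle) (φ : ConformalEquiv upperHalfPlaneSet R.carrier)
      (x : Fin 4 → ℝ), R.carrier = moduliShear α '' R'.carrier →
      (∀ i, R.pt i = moduliShear α (R'.pt i)) → R.IsUniformizing φ x →
      Tendsto (cornerCrossingProb t R') (𝓝[>] 0) (𝓝 (Literature.Probability.RandomPlanarGeometry.cardyFunction (crossRatio x))))
    (hβ : 0 < ((I - (α.re : ℂ)) / (α.im : ℂ)).im)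
    (w h : ℝ) (hw : 0 < w) (hh : 0 < h)
    (φ : ConformalEquiv upperHalfPlaneSet (rectQuad 0 w 0 h hw hh).carrier) (x : Fin 4 → ℝ)
    (hx : (rectQuad 0 w 0 h hw hh).IsUniformizing φ x) :
    Tendsto (cornerCrossingProb t
      ((rectQuad 0 w 0 h hw hh).map (shearHomeomorph ((I - (α.re : ℂ)) / (α.im : ℂ)) hβ.ne')))
      (𝓝[>] 0) (𝓝 (Literature.Probability.RandomPlanarGeometry.cardyFunction (crossRatio x))) := by
  refine hmod _ _ φ x ?_ (fun i => ?_) hx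
  · rw [MarkedDomain.carrier_map, Set.image_image, coe_shearHomeomorph]
    conv_lhs => rw [← Set.image_id (rectQuad 0 w 0 h hw hh).carrier]
    refine Set.image_congr' fun z => ?_
    rw [moduliShear_moduliShear, moduliShear_invParam hα.ne', moduliShear_I_apply, id]
  · rw [MarkedDomain.pt_map, coe_shearHomeomorph, moduliShear_moduliShear,
      moduliShear_invParam hα.ne', moduliShear_I_apply]

/-- The inverse shear parameter `β = (i - re α)/im α` lies in `ℍ` when `α` does. -/
theorem invParam_im_pos {α : ℂ} (hα : 0 < α.im) : 0 < ((I - (α.re : ℂ)) / (α.im : ℂ)).im := by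
  rw [Complex.div_ofReal_im]
  simp only [sub_im, I_im, ofReal_im, sub_zero]
  exact div_pos one_pos hα

/-- **The crux from the stubs.** `SegmentClosed`: UBC → UM → `G` closed. Sequences: if
`t n ∈ G` with moduli `α n` and `t n → t₀`, the inverse parameters `β n` lie in the compact `K`
of `stub_confinement` (via `pullback_constant`), a subsequence converges to `β₀ ∈ K ⊆ ℍ`, the
moduli `α n = (i - re β n)/im β n` converge to `α₀ ∈ ℍ` along it, and `stub_identification`
gives `CardyMod t₀ α₀`. -/
theorem segmentClosed_of_stubs :
    Summit.CriticalPhenomena.CardyFormulaZ2.Theses.CardySelfDualSegment.SegmentClosed := by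
  intro hUBC hUM
  -- the route's `CardyMod`, over the tree's `cornerCrossingProb` (literally the route's `P`)
  set CM : unitInterval → ℂ → Prop := fun t α => ∀ (R R' : ConformalRectangle)
    (φ : ConformalEquiv upperHalfPlaneSet R.carrier) (x : Fin 4 → ℝ),
    R.carrier = moduliShear α '' R'.carrier → (∀ i, R.pt i = moduliShear α (R'.pt i)) →
    R.IsUniformizing φ x → Tendsto (cornerCrossingProb t R') (𝓝[>] 0)
      (𝓝 (Literature.Probability.RandomPlanarGeometry.cardyFunction (crossRatio x))) with hCM
  change IsClosed {t | ∃ α : ℂ, 0 < α.im ∧ CM t α}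
  have hUBC' : ∀ ρ : ℝ, 0 < ρ → ∃ c > 0, ∃ n₀ : ℕ, ∀ t : unitInterval,
      BoxCrossingBounds (cornerPercolation t) squareLatticeEmbedding.z ρ c n₀ := hUBC
  have hUM' : ∀ (t₀ : unitInterval) (R : ConformalRectangle) (ε : ℝ), 0 < ε → ∃ η > 0,
      ∀ s : unitInterval, dist s t₀ < η → ∀ δ : ℝ, 0 < δ →
        |cornerCrossingProb s R δ - cornerCrossingProb t₀ R δ| < ε := hUM
  obtain ⟨K, hKc, hKH, hconf⟩ := stub_confinement hUBC'
  refine IsSeqClosed.isClosed fun ts t₀ hts hlim => ?_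
  choose αs hαs using hts
  set βs : ℕ → ℂ := fun n => (I - ((αs n).re : ℂ)) / ((αs n).im : ℂ) with hβs_def
  have hβs : ∀ n, 0 < (βs n).im := fun n => invParam_im_pos (hαs n).1
  have hβK : ∀ n, βs n ∈ K := fun n =>
    hconf (ts n) (βs n) (hβs n) fun w h hw hh φ x hx =>
      pullback_constant (hαs n).1 (hαs n).2 (hβs n) w h hw hh φ x hx
  obtain ⟨β₀, hβ₀K, ψ, hψ, hβlim⟩ := hKc.tendsto_subseq hβK
  have hβ₀ : 0 < β₀.im := hKH hβ₀K
  set α₀ : ℂ := (I - (β₀.re : ℂ)) / (β₀.im : ℂ) with hα₀_def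
  have hα₀ : 0 < α₀.im := invParam_im_pos hβ₀
  -- the moduli along the subsequence converge to `α₀`
  have hinv : ∀ n, αs n = (I - ((βs n).re : ℂ)) / ((βs n).im : ℂ) := by
    intro n
    have him : (αs n).im ≠ 0 := (hαs n).1.ne'
    have him' : ((αs n).im : ℂ) ≠ 0 := ofReal_ne_zero.2 him
    apply Complex.ext
    · simp [hβs_def, Complex.div_ofReal_re, Complex.div_ofReal_im]
      field_simp
    · simp [hβs_def, Complex.div_ofReal_re, Complex.div_ofReal_im]
  have hαlim : Tendsto (αs ∘ ψ) atTop (𝓝 α₀) := by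
    have hcont : ContinuousAt (fun β : ℂ => (I - (β.re : ℂ)) / (β.im : ℂ)) β₀ := by
      have h1 : ContinuousAt (fun β : ℂ => (I - (β.re : ℂ))) β₀ := by fun_prop
      have h2 : ContinuousAt (fun β : ℂ => (β.im : ℂ)) β₀ := by fun_prop
      exact h1.div h2 (ofReal_ne_zero.2 hβ₀.ne')
    have h := hcont.tendsto.comp hβlim
    refine (tendsto_congr fun k => ?_).1 h
    simp only [Function.comp_apply]
    exact (hinv (ψ k)).symm
  refine ⟨α₀, hα₀, ?_⟩
  intro R R' φ x hc hp hu
  exact stub_identification cornerCrossingProb (ts ∘ ψ) t₀ (αs ∘ ψ) α₀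
    (hlim.comp hψ.tendsto_atTop) hαlim (fun n => (hαs (ψ n)).1) hα₀ (hUM' t₀)
    (fun n => (hαs (ψ n)).2) R R' φ x hc hp hu

end Summit.CriticalPhenomena.CardyFormulaZ2.Cruxes.SegmentClosed.Sketch

/-- **`SegmentClosed` (stmt-CriticalPhenomena-5473).** -/
theorem Summit.CriticalPhenomena.CardyFormulaZ2.Theorems.segmentClosed_proof :
    Summit.CriticalPhenomena.CardyFormulaZ2.Theses.CardySelfDualSegment.SegmentClosed :=
  Summit.CriticalPhenomena.CardyFormulaZ2.Cruxes.SegmentClosed.Sketch.segmentClosed_of_stubs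

end
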